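import Literature.NumberTheory.EllipticCurves.PAdicLFunctionIntegralityAtTwoNonsplitMultProofs
import Literature.NumberTheory.EllipticCurves.PAdicGrossZagierConstantTermProofs
import HarnessLib

/-!
# The plus symbols `[a/pᵐ]⁺_f` at an ODD prime `p ∥ N`: the cusp class of `1/p`, the uniform bound
# `‖[a/pᵐ]⁺_f‖_p ≤ max(1, ‖[0]⁺_f‖_p)`, and `p`-integrality when `L(E, 1) = 0` (proofs only)

Topic `NumberTheory/EllipticCurves`; a *proofs* file (theorems only: no definition, no named fact;
D-0014/D-0026), the odd-`p` companion of `PAdicLFunctionIntegralityAtTwoSplitMultProofs`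
(`norm_ratPlusSymbol_val_div_le_two_of_split`) and `PAdicLFunctionIntegralityAtTwoNonsplitMultProofs`
(`norm_ratPlusSymbol_val_div_le_two_of_nonsplit`), for the objects of `PAdicLFunction`
(`ratPlusSymbol f r = [r]⁺_f`, the distribution `[a/pᵐ]⁺_f` of Mazur–Tate–Teitelbaum 1986 §I.10 with
`ε(p) = 0`, in the tree's normalisation `re Λ_f = ℤ · Ω⁺_f/2`).

THE POINT. The Riemann-sum certificate theorems for THE Mazur–Tate–Teitelbaum function at a
multiplicative prime (`IsMultPAdicLFunctionOf.norm_coeff_eq_of_nonsplit_of_lt`,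
`IsSplitMultPAdicLFunctionOf.norm_coeff_eq_of_split_of_lt`; the certificate shape
`Summit.…Iwasawa.RiemannSumUnitCertAt` and the O9 consumer
`Summit.…X2.bsdp_of_cellC_of_not_split_of_gvPar_of_thm1_of_riemannSum_certificate`) take as input a
UNIFORM bound `∀ m a, ‖[a/pᵐ]⁺_f‖_p ≤ C` over ALL levels `m` (hypothesis `hC`), which no finite table
of symbols supplies and which the tree so far only knows to EXIST (`exists_norm_ratPlusSymbol_le`,
Manin–Drinfeld, inexplicit). At an odd prime `p` dividing the level exactly once — the level of the
newform of an elliptic curve with multiplicative reduction at `p` — the bound is EXPLICIT and needs no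
hypothesis on `E[p]`, on the `p`-adic image or on the Manin constant:

* §1 (`exists_ratPlusSymbol_sub_inv_eq_div_two`): **`[r]⁺_f − [1/p]⁺_f ∈ ½ℤ`** for every cusp `r`
  of `p`-power denominator `≥ p` (`N = pM`, `p ∤ M`; rational real-coefficient symbols): all such
  cusps are `Γ₀(N)`-equivalent to `1/p` (`modularSymbol_div_sub_inv_mem_periodLattice`, Cremona 1997
  Lemma 2.2.3 (3); Manin 1972 Prop. 1.4, Thm. 1.6) and `re Λ_f = ℤ · Ω⁺_f/2`
  (`exists_ratPlusSymbol_sub_eq_div_two_of_sub_mem`);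
* §2 (`norm_ratPlusSymbol_inv_le_max`): **`‖[1/p]⁺_f‖_p ≤ max(1, ‖[0]⁺_f‖_p)`** for `p` odd with
  `a_p(f) = a_p ∈ ℤ`: the `U_p`-relation at `r = 0` with `ε(p) = 0`,
  `a_p [0]⁺ = ∑_{j mod p} [j/p]⁺` (`intCast_mul_ratPlusSymbol_of_dvd`, MTT §I.4 (4.2)), reads
  `(p − 1)[1/p]⁺ ≡ (a_p − 1)[0]⁺ (mod ½ℤ)` by §1, and `p − 1`, `2` are `p`-adic units;
* §3 (`norm_ratPlusSymbol_val_div_le_max`, `…_le_one_of_norm_zero_le_one`): hence the UNIFORM bound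
  **`‖[a/pᵐ]⁺_f‖_p ≤ max(1, ‖[0]⁺_f‖_p)` for all `m` and all `a ∈ ℤ/pᵐ`** (the class `a = 0` is
  the cusp `0` itself), and `≤ 1` as soon as `‖[0]⁺_f‖_p ≤ 1` — in particular when `[0]⁺_f = 0`;
* §4 (elliptic curves; `IsNewformOf.norm_ratPlusSymbol_val_div_le_max_of_multiplicative`,
  `IsNewformOf.norm_ratPlusSymbol_val_div_le_one_of_multiplicative_of_entireLFunction_eq_zero`): for
  the newform `f` of `E = W/ℚ` with multiplicative reduction at an odd `p` the level hypotheses hold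
  (`a_p(f) = ±1`, `p ∣ N`, `p² ∤ N`: `IsNewformOf.cuspCoeff_eq_one_and_sq_of_split` /
  `IsNewformOf.cuspCoeff_eq_neg_one_and_dvd_of_nonsplit`, `IsNewformOf.dvd_level_of_split`,
  `IsNewformOf.not_sq_dvd_level_of_lFunction_ne_zero`), so `‖[a/pᵐ]⁺_f‖_p ≤ max(1, ‖[0]⁺_f‖_p)`
  with `[0]⁺_f = L(E,1)/Ω⁺_f`, and **`‖[a/pᵐ]⁺_f‖_p ≤ 1` for all `m, a` whenever `L(E, 1) = 0`**
  (`ratPlusSymbol_zero_eq_zero_of_entireLFunction_eq_zero`) — the `hC` of the rank-one certificate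
  consumers with `C = 1`, unconditionally.

STATUS IN PRINT. Ingredients: Manin's cusp relation / `Γ₀(N)`-equivalence of cusps (Manin 1972,
Prop. 1.4, Thm. 1.6; Cremona 1997, §2.2 Lemma 2.2.3), the Hecke relation MTT §I.4 (4.2) at `p ∣ N`,
and the period conventions of Cremona §2.8 / MTT §I.8; the bound in THIS normalisation is a theorem
of the tree's definitions, not printed as such (compare Greenberg–Vatsal 2000 Prop. 3.7, which bounds
the Néron-normalised symbols under `E[p]` irreducible or optimality; no such hypothesis is needed for
the `Ω⁺_f`-normalised symbols at the cusps of `p`-power denominator when `p ∥ N`). Requested by the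
residual cell `b2b-bsdres` (CLASS-CLOSURE lane, class O9 = X2c, typer cc-typer-6 GEN 10;
`class-closure/O9/O9-window57-unitcoeff-instantiation.README-typer6.md` §5, the `C`-clause).
EVIDENCE before this proof (census, not used): `sym_den_shift = 0` on 749/749 O9 window rows and on
138/138 N8 rows (cc-eng-6 MU window v0 FINAL; all of analytic rank one).

## References

* Ju. I. Manin, *Parabolic points and zeta functions of modular curves*, Izv. Akad. Nauk SSSR 36
  (1972), Prop. 1.4, Thm. 1.6. [Manin1972]
* J. E. Cremona, *Algorithms for modular elliptic curves*, 2nd ed. (1997), §2.2 Lemma 2.2.3, §2.8.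
  [CremonaAlgorithms1997]
* B. Mazur, J. Tate, J. Teitelbaum, *On `p`-adic analogues of the conjectures of Birch and
  Swinnerton-Dyer*, Invent. Math. 84 (1986), §I.4 (4.2), §I.8, §I.10. [MazurTateTeitelbaum1986Invent]
* R. Greenberg, V. Vatsal, *On the Iwasawa invariants of elliptic curves*, Invent. Math. 142 (2000),
  Prop. (3.7). [GreenbergVatsal2000]
-/

set_option autoImplicit false

noncomputable section

open scoped MatrixGroups ModularForm

open CongruenceSubgroup WeierstrassCurve Literature.NumberTheory.EllipticCurves.ModularForms

namespace Literature.NumberTheory.EllipticCurves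

/-! ### §1. The cusp class of `1/p` for `p ∥ N`: `[r]⁺_f − [1/p]⁺_f ∈ ½ℤ` -/

section CuspClass

variable {N : ℕ} [NeZero N] (f : CuspForm (Gamma0 N) 2) {p : ℕ} [Fact p.Prime]

omit [NeZero N] [Fact p.Prime] in
/-- The denominator of `v / pʲ` divides `pʲ` (`v p j : ℕ`; private arithmetic helper). [folklore] -/
private theorem den_natCast_div_pow_dvd (v j : ℕ) :
    (((v : ℕ) : ℚ) / ((p : ℕ) : ℚ) ^ j).den ∣ p ^ j := by
  have h := Rat.den_dvd (v : ℤ) ((p : ℤ) ^ j)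
  rw [Rat.divInt_eq_div] at h
  push_cast at h
  exact_mod_cast h

/-- **`[r]⁺_f − [1/p]⁺_f ∈ ½ℤ` at every cusp of `p`-power denominator `≥ p`, for `p ∣ N`, `p² ∤ N`**
(`N = pM`, `p ∤ M`; rational real-coefficient symbols `hrat`/`hreal`): `{∞, r} ≡ {∞, 1/p} (mod Λ_f)`
(`modularSymbol_div_sub_inv_mem_periodLattice`: all cusps `a/pᵐ`, `m ≥ 1`, `p ∤ a`, are
`Γ₀(pM)`-equivalent to `1/p`, Cremona Lemma 2.2.3 (3)), and `re Λ_f = ℤ · Ω⁺_f/2`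
(`exists_ratPlusSymbol_sub_eq_div_two_of_sub_mem`). The odd-`p` twin of
`exists_ratPlusSymbol_sub_half_eq_div_two`. [cite: CremonaAlgorithms1997, §2.2 Lemma 2.2.3]
[cite: MazurTateTeitelbaum1986Invent, §I.8] -/
theorem exists_ratPlusSymbol_sub_inv_eq_div_two
    (hrat : ∀ r : ℚ, (ratPlusSymbol f r : ℝ) = normalizedPlusSymbol f r)
    (hreal : ∀ n, (cuspCoeff f n).im = 0) (hpN : p ∣ N) (hp2N : ¬ p ^ 2 ∣ N)
    {r : ℚ} {n : ℕ} (hr : r.den ∣ p ^ n) (hr1 : r.den ≠ 1) :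
    ∃ k : ℤ, ratPlusSymbol f r - ratPlusSymbol f (1 / (p : ℚ)) = (k : ℚ) / 2 := by
  have hp : p.Prime := Fact.out
  obtain ⟨m, -, hm⟩ := (Nat.dvd_prime_pow hp).mp hr
  have hm0 : m ≠ 0 := by
    rintro rfl
    rw [pow_zero] at hm
    exact hr1 hm
  obtain ⟨m', rfl⟩ : ∃ m', m = m' + 1 := ⟨m - 1, by omega⟩
  obtain ⟨M, hM⟩ := hpN
  have hpM : ¬ p ∣ M := fun ⟨t, ht⟩ ↦ hp2N ⟨t, by rw [hM, ht]; ring⟩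
  have hN : (N : ℤ) = (p : ℤ) * (M : ℤ) := by exact_mod_cast hM
  have hden : ((r.den : ℕ) : ℤ) = (p : ℤ) * ((p : ℤ) ^ m') := by rw [hm]; push_cast; ring
  have hden0 : ((r.den : ℕ) : ℤ) ≠ 0 := by exact_mod_cast r.den_ne_zero
  have hac : IsCoprime r.num ((r.den : ℕ) : ℤ) := by
    rw [Int.isCoprime_iff_gcd_eq_one, Int.gcd, Int.natAbs_natCast]
    exact r.reduced
  have hpM' : IsCoprime (p : ℤ) (M : ℤ) :=
    Nat.isCoprime_iff_coprime.mpr ((Nat.Prime.coprime_iff_not_dvd hp).mpr hpM)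
  have hcM : IsCoprime ((r.den : ℕ) : ℤ) (M : ℤ) := by
    rw [hden, ← pow_succ']
    exact hpM'.pow_left
  have h := modularSymbol_div_sub_inv_mem_periodLattice f hN hden hden0 hac hcM
  have hr' : ((r.num : ℤ) : ℚ) / (((r.den : ℕ) : ℤ) : ℚ) = r := by
    push_cast
    exact Rat.num_div_den r
  rw [hr'] at h
  exact exists_ratPlusSymbol_sub_eq_div_two_of_sub_mem f hrat hreal h

/-- `[x/pʲ]⁺_f − [1/p]⁺_f ∈ ½ℤ` for `x ∈ ℤ/pʲ`, `x ≠ 0` (`p ∣ N`, `p² ∤ N`): the rational number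
`x.val/pʲ ∈ (0, 1)` has `p`-power denominator `≠ 1`. [cite: CremonaAlgorithms1997, §2.2 Lemma 2.2.3] -/
theorem exists_ratPlusSymbol_val_div_sub_inv_eq_div_two
    (hrat : ∀ r : ℚ, (ratPlusSymbol f r : ℝ) = normalizedPlusSymbol f r)
    (hreal : ∀ n, (cuspCoeff f n).im = 0) (hpN : p ∣ N) (hp2N : ¬ p ^ 2 ∣ N)
    {j : ℕ} {x : ZMod (p ^ j)} (hx : x ≠ 0) :
    ∃ k : ℤ, ratPlusSymbol f (((x.val : ℕ) : ℚ) / ((p : ℕ) : ℚ) ^ j) -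
      ratPlusSymbol f (1 / (p : ℚ)) = (k : ℚ) / 2 := by
  have hp : p.Prime := Fact.out
  haveI : NeZero (p ^ j) := ⟨pow_ne_zero _ hp.ne_zero⟩
  set r : ℚ := ((x.val : ℕ) : ℚ) / ((p : ℕ) : ℚ) ^ j with hr_def
  have hr : r.den ∣ p ^ j := den_natCast_div_pow_dvd x.val j
  have hr1 : r.den ≠ 1 := by
    intro h1
    have hv0 : x.val ≠ 0 := fun h0 ↦ hx ((ZMod.val_eq_zero x).mp h0)
    have hvlt : x.val < p ^ j := ZMod.val_lt x
    have hp0 : (0 : ℚ) < ((p : ℕ) : ℚ) := by exact_mod_cast hp.pos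
    have hr0 : 0 < r := by
      rw [hr_def]
      have : (0 : ℚ) < ((x.val : ℕ) : ℚ) := by exact_mod_cast Nat.pos_of_ne_zero hv0
      positivity
    have hrlt : r < 1 := by
      rw [hr_def, div_lt_one (by positivity)]
      exact_mod_cast hvlt
    have hrint : (r.num : ℚ) = r := by
      conv_rhs => rw [← Rat.num_div_den r]
      rw [h1]; simp
    have h0 : (0 : ℚ) < r.num := by rw [hrint]; exact hr0
    have h1' : (r.num : ℚ) < 1 := by rw [hrint]; exact hrlt
    have h0z : 0 < r.num := by exact_mod_cast h0
    have h1z : r.num < 1 := by exact_mod_cast h1'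
    omega
  exact exists_ratPlusSymbol_sub_inv_eq_div_two f hrat hreal hpN hp2N hr hr1

end CuspClass

/-! ### §2. `‖[1/p]⁺_f‖_p ≤ max(1, ‖[0]⁺_f‖_p)` from the `U_p`-relation at the cusp `0` -/

section Norms

variable {N : ℕ} [NeZero N] (f : CuspForm (Gamma0 N) 2) {p : ℕ} [Fact p.Prime]

omit [NeZero N] in
/-- `‖2‖_p = 1` for an odd prime `p` (private helper). [folklore] -/
private theorem padicNorm_two_eq_one (hp2 : p ≠ 2) : ‖(2 : ℚ_[p])‖ = 1 := by
  have hp : p.Prime := Fact.out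
  have hle : ‖((2 : ℤ) : ℚ_[p])‖ ≤ 1 := Padic.norm_int_le_one _
  have hnot : ¬ ‖((2 : ℤ) : ℚ_[p])‖ < 1 := by
    rw [Padic.norm_intCast_lt_one_iff]
    intro hdvd
    have h2 : p ∣ 2 := by exact_mod_cast hdvd
    exact hp2 ((Nat.prime_dvd_prime_iff_eq hp Nat.prime_two).mp h2)
  push_cast at hle hnot
  exact le_antisymm hle (not_lt.mp hnot)

omit [NeZero N] in
/-- `‖k/2‖_p ≤ 1` for `k ∈ ℤ` and an odd prime `p` (private helper). [folklore] -/
private theorem norm_intCast_div_two_le_one (hp2 : p ≠ 2) (k : ℤ) :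
    ‖(((k : ℚ) / 2 : ℚ) : ℚ_[p])‖ ≤ 1 := by
  push_cast
  rw [norm_div, padicNorm_two_eq_one hp2, div_one]
  have h := Padic.norm_int_le_one (p := p) k
  simpa using h

omit [NeZero N] in
/-- `‖p − 1‖_p = 1` (private helper). [folklore] -/
private theorem padicNorm_natCast_sub_one_eq_one : ‖((p : ℚ_[p]) - 1)‖ = 1 := by
  have hp : p.Prime := Fact.out
  have hle : ‖(((p : ℤ) - 1 : ℤ) : ℚ_[p])‖ ≤ 1 := Padic.norm_int_le_one _
  have hnot : ¬ ‖(((p : ℤ) - 1 : ℤ) : ℚ_[p])‖ < 1 := by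
    rw [Padic.norm_intCast_lt_one_iff]
    intro hdvd
    have h1 : (p : ℤ) ∣ 1 := by
      have := dvd_sub (dvd_refl (p : ℤ)) hdvd
      simpa using this
    exact hp.one_lt.ne' (by exact_mod_cast Int.eq_one_of_dvd_one (by positivity) h1)
  push_cast at hle hnot
  exact le_antisymm hle (not_lt.mp hnot)

/-- **`‖[1/p]⁺_f‖_p ≤ max(1, ‖[0]⁺_f‖_p)` for an odd prime `p ∣ N`, `p² ∤ N`, with `a_p(f) = a_p ∈ ℤ`**
(rational real-coefficient symbols). The `U_p`-relation with `ε(p) = 0` at `r = 0`,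
`a_p [0]⁺ = ∑_{j mod p} [j/p]⁺ = [0]⁺ + ∑_{0 < j < p} [j/p]⁺` (`intCast_mul_ratPlusSymbol_of_dvd`,
MTT §I.4 (4.2)), and `[j/p]⁺ ≡ [1/p]⁺ (mod ½ℤ)` for `0 < j < p` (§1) give
`(p − 1)·[1/p]⁺ = (a_p − 1)·[0]⁺ + k/2`, `k ∈ ℤ`; `p − 1` and `2` are `p`-adic units.
[cite: MazurTateTeitelbaum1986Invent, §I.4 (4.2) and §I.10 (ε(p) = 0)]
[cite: CremonaAlgorithms1997, §2.2 Lemma 2.2.3] -/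
theorem norm_ratPlusSymbol_inv_le_max (hp2 : p ≠ 2) (hf : IsNewform0 f)
    (hrat : ∀ r : ℚ, (ratPlusSymbol f r : ℝ) = normalizedPlusSymbol f r)
    (hreal : ∀ n, (cuspCoeff f n).im = 0) (hpN : p ∣ N) (hp2N : ¬ p ^ 2 ∣ N)
    {ap : ℤ} (hap : cuspCoeff f p = ap) :
    ‖((ratPlusSymbol f (1 / (p : ℚ)) : ℚ) : ℚ_[p])‖ ≤
      max 1 ‖((ratPlusSymbol f 0 : ℚ) : ℚ_[p])‖ := by
  have hp : p.Prime := Fact.out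
  haveI : NeZero p := ⟨hp.ne_zero⟩
  -- the `U_p`-relation at `r = 0`, as a sum over `Finset.range p`
  set F : ℕ → ℚ := fun j ↦ ratPlusSymbol f ((0 + (j : ℚ)) / p) with hF_def
  have hU : (ap : ℚ) * ratPlusSymbol f 0 = ∑ j ∈ Finset.range p, F j := by
    rw [intCast_mul_ratPlusSymbol_of_dvd p hf hp hpN hap hrat 0, ← Fin.sum_univ_eq_sum_range]
  -- each `[(j+1)/p]⁺`, `j + 1 < p`, is `[1/p]⁺ + k_j/2`
  have hclass : ∀ j : ℕ, ∃ k : ℤ, j + 1 < p →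
      F (j + 1) = ratPlusSymbol f (1 / (p : ℚ)) + (k : ℚ) / 2 := by
    intro j
    by_cases hj : j + 1 < p
    · haveI : NeZero (p ^ 1) := ⟨pow_ne_zero _ hp.ne_zero⟩
      have hjlt : j + 1 < p ^ 1 := by rwa [pow_one]
      set x : ZMod (p ^ 1) := ((j + 1 : ℕ) : ZMod (p ^ 1)) with hx_def
      have hxval : x.val = j + 1 := by
        rw [hx_def, ZMod.val_natCast, Nat.mod_eq_of_lt hjlt]
      have hx : x ≠ 0 := by
        intro h0
        have : x.val = 0 := by rw [h0, ZMod.val_zero]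
        omega
      obtain ⟨k, hk⟩ := exists_ratPlusSymbol_val_div_sub_inv_eq_div_two f hrat hreal hpN hp2N hx
      refine ⟨k, fun _ ↦ ?_⟩
      have heq : F (j + 1) = ratPlusSymbol f (((x.val : ℕ) : ℚ) / ((p : ℕ) : ℚ) ^ 1) := by
        simp only [hF_def, hxval, pow_one, zero_add]
      rw [heq]
      linear_combination hk
    · exact ⟨0, fun h ↦ absurd h hj⟩
  choose k hk using hclass
  -- sum the relation over `j`: `∑_{j < p} F j = [0]⁺ + (p − 1)[1/p]⁺ + (∑ k_j)/2`
  have hF0 : F 0 = ratPlusSymbol f 0 := by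
    rw [hF_def]
    simp
  have hp1' : p - 1 + 1 = p := Nat.sub_add_cancel hp.pos
  have hsum : ∑ j ∈ Finset.range p, F j =
      ratPlusSymbol f 0 + ((p : ℚ) - 1) * ratPlusSymbol f (1 / (p : ℚ)) +
        (∑ j ∈ Finset.range (p - 1), (k j : ℚ)) / 2 := by
    conv_lhs => rw [← hp1', Finset.sum_range_succ']
    rw [hF0, Finset.sum_congr rfl fun j hj ↦ hk j (by
      have := Finset.mem_range.mp hj; omega), Finset.sum_add_distrib, Finset.sum_const,
      Finset.card_range, nsmul_eq_mul, Finset.sum_div]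
    push_cast [Nat.cast_sub hp.pos]
    ring
  rw [hsum] at hU
  -- solve for `[1/p]⁺`
  set Kz : ℤ := ∑ j ∈ Finset.range (p - 1), k j with hKz_def
  have hKz : (∑ j ∈ Finset.range (p - 1), (k j : ℚ)) = (Kz : ℚ) := by
    rw [hKz_def]
    push_cast
    rfl
  rw [hKz] at hU
  have hp1 : (p : ℚ) - 1 ≠ 0 := by
    have : (1 : ℚ) < p := by exact_mod_cast hp.one_lt
    linarith
  have hsolve : ratPlusSymbol f (1 / (p : ℚ)) =
      (((ap : ℚ) - 1) * ratPlusSymbol f 0 - (Kz : ℚ) / 2) / ((p : ℚ) - 1) := by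
    rw [eq_div_iff hp1]
    linear_combination (-1 : ℚ) * hU
  rw [hsolve]
  push_cast
  rw [norm_div, padicNorm_natCast_sub_one_eq_one, div_one]
  have hA : ‖((ap : ℚ_[p]) - 1) * ((ratPlusSymbol f 0 : ℚ) : ℚ_[p])‖ ≤
      ‖((ratPlusSymbol f 0 : ℚ) : ℚ_[p])‖ := by
    rw [norm_mul]
    have h1 : ‖((ap : ℚ_[p]) - 1)‖ ≤ 1 := by
      have h := Padic.norm_int_le_one (p := p) (ap - 1)
      simpa using h
    exact mul_le_of_le_one_left (norm_nonneg _) h1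
  have hB : ‖((Kz : ℚ_[p]) / 2)‖ ≤ 1 := by
    have h := norm_intCast_div_two_le_one hp2 Kz
    push_cast at h
    exact h
  calc ‖((ap : ℚ_[p]) - 1) * ((ratPlusSymbol f 0 : ℚ) : ℚ_[p]) - (Kz : ℚ_[p]) / 2‖
      ≤ max ‖((ap : ℚ_[p]) - 1) * ((ratPlusSymbol f 0 : ℚ) : ℚ_[p])‖ ‖(Kz : ℚ_[p]) / 2‖ := by
        rw [sub_eq_add_neg, ← norm_neg ((Kz : ℚ_[p]) / 2)]
        exact Padic.nonarchimedean _ _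
    _ ≤ max ‖((ratPlusSymbol f 0 : ℚ) : ℚ_[p])‖ 1 := max_le_max hA hB
    _ = max 1 ‖((ratPlusSymbol f 0 : ℚ) : ℚ_[p])‖ := max_comm _ _

/-! ### §3. The uniform bound `‖[a/pᵐ]⁺_f‖_p ≤ max(1, ‖[0]⁺_f‖_p)` over all levels -/

/-- **`‖[a/pᵐ]⁺_f‖_p ≤ max(1, ‖[0]⁺_f‖_p)` for ALL `m` and all `a ∈ ℤ/pᵐ`**, at an odd prime `p ∣ N`,
`p² ∤ N`, with `a_p(f) = a_p ∈ ℤ` (rational real-coefficient symbols): the class `a = 0` is the cusp `0`;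
every other `a.val/pᵐ ∈ (0,1)` lies in the cusp class of `1/p` (§1), so
`[a/pᵐ]⁺ = [1/p]⁺ + k/2` with `‖[1/p]⁺‖_p ≤ max(1, ‖[0]⁺‖_p)` (§2) and `‖k/2‖_p ≤ 1`. This is the
UNIFORM bound `hC` of the Riemann-sum certificate theorems (`IsMultPAdicLFunctionOf.norm_coeff_eq_of_nonsplit_of_lt`
and kin), explicit and read off ONE symbol value. [cite: MazurTateTeitelbaum1986Invent, §I.4 (4.2), §I.8 and §I.10]
[cite: CremonaAlgorithms1997, §2.2 Lemma 2.2.3] -/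
theorem norm_ratPlusSymbol_val_div_le_max (hp2 : p ≠ 2) (hf : IsNewform0 f)
    (hrat : ∀ r : ℚ, (ratPlusSymbol f r : ℝ) = normalizedPlusSymbol f r)
    (hreal : ∀ n, (cuspCoeff f n).im = 0) (hpN : p ∣ N) (hp2N : ¬ p ^ 2 ∣ N)
    {ap : ℤ} (hap : cuspCoeff f p = ap) (m : ℕ) (a : ZMod (p ^ m)) :
    ‖((ratPlusSymbol f (((a.val : ℕ) : ℚ) / ((p : ℕ) : ℚ) ^ m) : ℚ) : ℚ_[p])‖ ≤
      max 1 ‖((ratPlusSymbol f 0 : ℚ) : ℚ_[p])‖ := by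
  by_cases ha : a = 0
  · subst ha
    rw [ZMod.val_zero, Nat.cast_zero, zero_div]
    exact le_max_right _ _
  · obtain ⟨k, hk⟩ := exists_ratPlusSymbol_val_div_sub_inv_eq_div_two f hrat hreal hpN hp2N ha
    have hk' : ratPlusSymbol f (((a.val : ℕ) : ℚ) / ((p : ℕ) : ℚ) ^ m) =
        ratPlusSymbol f (1 / (p : ℚ)) + (k : ℚ) / 2 := by linear_combination hk
    rw [hk']
    push_cast
    have h1 := norm_ratPlusSymbol_inv_le_max f hp2 hf hrat hreal hpN hp2N hap
    have h2 : ‖((k : ℚ_[p]) / 2)‖ ≤ 1 := by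
      have h := norm_intCast_div_two_le_one hp2 k
      push_cast at h
      exact h
    have h1' : ‖((ratPlusSymbol f (1 / (p : ℚ)) : ℚ) : ℚ_[p])‖ =
        ‖((ratPlusSymbol f (1 / ((p : ℕ) : ℚ)) : ℚ) : ℚ_[p])‖ := rfl
    calc ‖((ratPlusSymbol f (1 / ((p : ℕ) : ℚ)) : ℚ) : ℚ_[p]) + (k : ℚ_[p]) / 2‖
        ≤ max ‖((ratPlusSymbol f (1 / ((p : ℕ) : ℚ)) : ℚ) : ℚ_[p])‖ ‖(k : ℚ_[p]) / 2‖ :=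
          Padic.nonarchimedean _ _
      _ ≤ max (max 1 ‖((ratPlusSymbol f 0 : ℚ) : ℚ_[p])‖) 1 := max_le_max (h1' ▸ h1) h2
      _ = max 1 ‖((ratPlusSymbol f 0 : ℚ) : ℚ_[p])‖ := by
          rw [max_comm, ← max_assoc, max_self]

/-- **`‖[a/pᵐ]⁺_f‖_p ≤ 1` for all `m, a` as soon as `‖[0]⁺_f‖_p ≤ 1`** (odd `p ∣ N`, `p² ∤ N`,
`a_p(f) ∈ ℤ`): the bound `hC` with `C = 1`. [cite: MazurTateTeitelbaum1986Invent, §I.4 (4.2), §I.8 and §I.10] -/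
theorem norm_ratPlusSymbol_val_div_le_one_of_norm_zero_le_one (hp2 : p ≠ 2) (hf : IsNewform0 f)
    (hrat : ∀ r : ℚ, (ratPlusSymbol f r : ℝ) = normalizedPlusSymbol f r)
    (hreal : ∀ n, (cuspCoeff f n).im = 0) (hpN : p ∣ N) (hp2N : ¬ p ^ 2 ∣ N)
    {ap : ℤ} (hap : cuspCoeff f p = ap) (h0 : ‖((ratPlusSymbol f 0 : ℚ) : ℚ_[p])‖ ≤ 1)
    (m : ℕ) (a : ZMod (p ^ m)) :
    ‖((ratPlusSymbol f (((a.val : ℕ) : ℚ) / ((p : ℕ) : ℚ) ^ m) : ℚ) : ℚ_[p])‖ ≤ 1 :=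
  (norm_ratPlusSymbol_val_div_le_max f hp2 hf hrat hreal hpN hp2N hap m a).trans (max_le le_rfl h0)

end Norms

end Literature.NumberTheory.EllipticCurves

/-! ### §4. Elliptic curves: the newform of `E` at an odd prime of multiplicative reduction -/

namespace Literature.NumberTheory.EllipticCurves.ModularForms

section EllipticCurve

variable {W : WeierstrassCurve ℚ} {N : ℕ} [NeZero N] {f : CuspForm (Gamma0 N) 2}
  {p : ℕ} [Fact p.Prime]

/-- **Level data at a multiplicative prime**: for the newform `f` of `E = W/ℚ` and a prime `p` of
multiplicative reduction, `p ∣ N`, `p² ∤ N` and `a_p(f) = a_p(E) ∈ {1, −1}` — split: `a_p = 1`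
(`IsNewformOf.cuspCoeff_eq_one_and_sq_of_split`, `IsNewformOf.dvd_level_of_split`); non-split:
`a_p = −1`, `p ∣ N` (`IsNewformOf.cuspCoeff_eq_neg_one_and_dvd_of_nonsplit`); and `p² ∣ N` would force
`a_p(f) = 0` (Atkin–Lehner 1970 Thm. 3, `IsNewformOf.not_sq_dvd_level_of_lFunction_ne_zero`).
[cite: AtkinLehner1970, Thm. 3] [cite: SilvermanAEC2009, §C.16 (definition of L_v(T)), PDF p. 390] -/
theorem IsNewformOf.dvd_level_and_not_sq_dvd_of_multiplicative (hf : IsNewformOf W f)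
    (hmult : W.HasMultiplicativeReductionAtPrime p) :
    p ∣ N ∧ ¬ p ^ 2 ∣ N ∧ ∃ ap : ℤ, cuspCoeff f p = ap ∧ (ap = 1 ∨ ap = -1) := by
  have hp : p.Prime := Fact.out
  by_cases hs : W.HasSplitMultiplicativeReductionAtPrime p
  · have ha : cuspCoeff f p = 1 := (hf.cuspCoeff_eq_one_and_sq_of_split hs).1
    have hLp : W.LFunction p ≠ 0 := by
      intro h0
      rw [hf.2 p, h0] at ha
      norm_num at ha
    exact ⟨hf.dvd_level_of_split hs, hf.not_sq_dvd_level_of_lFunction_ne_zero hp hLp,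
      1, by rw [ha, Int.cast_one], Or.inl rfl⟩
  · obtain ⟨ha, hpN⟩ := hf.cuspCoeff_eq_neg_one_and_dvd_of_nonsplit hmult hs
    have hLp : W.LFunction p ≠ 0 := by
      intro h0
      rw [hf.2 p, h0] at ha
      norm_num at ha
    exact ⟨hpN, hf.not_sq_dvd_level_of_lFunction_ne_zero hp hLp,
      -1, by rw [ha, Int.cast_neg, Int.cast_one], Or.inr rfl⟩

/-- **`‖[a/pᵐ]⁺_f‖_p ≤ max(1, ‖[0]⁺_f‖_p)` for the newform of `E` at an ODD multiplicative prime `p`**,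
for all `m` and all `a ∈ ℤ/pᵐ` — no hypothesis on `E[p]`, the `p`-adic image, optimality or the
Manin constant (`[0]⁺_f = L(E,1)/Ω⁺_f`). Rationality and reality of the symbols of `f`:
`ratCast_ratPlusSymbol_holds`, `cuspCoeff_im_eq_zero_of_coeffField_eq_bot`.
[cite: MazurTateTeitelbaum1986Invent, §I.4 (4.2), §I.8 and §I.10] [cite: CremonaAlgorithms1997, §2.2 Lemma 2.2.3] -/
theorem IsNewformOf.norm_ratPlusSymbol_val_div_le_max_of_multiplicative (hf : IsNewformOf W f)
    (hp2 : p ≠ 2) (hmult : W.HasMultiplicativeReductionAtPrime p) (m : ℕ) (a : ZMod (p ^ m)) :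
    ‖((ratPlusSymbol f (((a.val : ℕ) : ℚ) / ((p : ℕ) : ℚ) ^ m) : ℚ) : ℚ_[p])‖ ≤
      max 1 ‖((ratPlusSymbol f 0 : ℚ) : ℚ_[p])‖ := by
  have hQ : coeffField f = ⊥ := hf.coeffField_eq_bot
  obtain ⟨hpN, hp2N, ap, hap, -⟩ := hf.dvd_level_and_not_sq_dvd_of_multiplicative hmult
  exact norm_ratPlusSymbol_val_div_le_max f hp2 hf.1 (ratCast_ratPlusSymbol_holds hf.1 hQ)
    (cuspCoeff_im_eq_zero_of_coeffField_eq_bot hQ) hpN hp2N hap m a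

/-- **`‖[a/pᵐ]⁺_f‖_p ≤ 1` for all `m, a`, for the newform of `E` at an odd multiplicative prime `p`,
whenever `L(E, 1) = 0`** (`[0]⁺_f = 0`, `ratPlusSymbol_zero_eq_zero_of_entireLFunction_eq_zero`): the
uniform bound `hC` of the rank-`≥ 1` Riemann-sum certificate consumers with `C = 1`, unconditionally.
[cite: MazurTateTeitelbaum1986Invent, §I.4 (4.2), §I.8 and §I.10] [cite: CremonaAlgorithms1997, §2.2 Lemma 2.2.3] -/
theorem IsNewformOf.norm_ratPlusSymbol_val_div_le_one_of_multiplicative_of_entireLFunction_eq_zero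
    (hf : IsNewformOf W f) (hp2 : p ≠ 2) (hmult : W.HasMultiplicativeReductionAtPrime p)
    (hL : W.entireLFunction 1 = 0) (m : ℕ) (a : ZMod (p ^ m)) :
    ‖((ratPlusSymbol f (((a.val : ℕ) : ℚ) / ((p : ℕ) : ℚ) ^ m) : ℚ) : ℚ_[p])‖ ≤ 1 := by
  refine (hf.norm_ratPlusSymbol_val_div_le_max_of_multiplicative hp2 hmult m a).trans
    (max_le le_rfl ?_)
  rw [ratPlusSymbol_zero_eq_zero_of_entireLFunction_eq_zero hf hL, Rat.cast_zero, norm_zero]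
  exact zero_le_one

/-- **`‖[a/pᵐ]⁺_f‖_p ≤ 1` for all `m, a`, for the newform of `E` at an odd multiplicative prime `p`,
in POSITIVE analytic rank** (`W.analyticRank ≠ 0 ⇒ L(E,1) = 0`, Mathlib
`apply_eq_zero_of_analyticOrderNatAt_ne_zero`). The `hC` of the rank-one certificate consumers
(`Summit.…X2.bsdp_of_cellC_of_not_split_of_gvPar_of_thm1_of_riemannSum_certificate`, the `C`-clause of
`Summit.…Iwasawa.RiemannSumUnitCertAt`) with `C = 1`. [cite: MazurTateTeitelbaum1986Invent, §I.4 (4.2), §I.8 and §I.10]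
[cite: CremonaAlgorithms1997, §2.2 Lemma 2.2.3] -/
theorem IsNewformOf.norm_ratPlusSymbol_val_div_le_one_of_multiplicative_of_analyticRank_ne_zero
    (hf : IsNewformOf W f) (hp2 : p ≠ 2) (hmult : W.HasMultiplicativeReductionAtPrime p)
    (hr : W.analyticRank ≠ 0) (m : ℕ) (a : ZMod (p ^ m)) :
    ‖((ratPlusSymbol f (((a.val : ℕ) : ℚ) / ((p : ℕ) : ℚ) ^ m) : ℚ) : ℚ_[p])‖ ≤ 1 :=
  hf.norm_ratPlusSymbol_val_div_le_one_of_multiplicative_of_entireLFunction_eq_zero hp2 hmult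
    (apply_eq_zero_of_analyticOrderNatAt_ne_zero hr) m a

end EllipticCurve

end Literature.NumberTheory.EllipticCurves.ModularForms

end
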